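import Mathlib
import HarnessLib
import Summits.NavierStokesRegularity.NavierStokesRegularity.Theorems.TaylorModelRungThreeSoundnessVectorPair

/-!
# Line `taylor-model` on crux K1b-DR (`ExactWindowRungThree.DerivativeEnclosureCertificateR`,
# stmt-NavierStokesRegularity-23954) — VECTOR STEP LEMMA, part 4: differentiable dependence on the initial
# condition along a segment, WITHOUT step restriction

Supplier of the C¹ clauses (K1b-DR's LIP / (F4)-shape "segment derivatives") for LONG sub-steps of the
componentwise-majorant pivot (`pub/pub-ns-dss/certificates/S1-VECTOR-23954.md`, director dss_56/dss_58).  Setting of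
parts 1–3 (finite `ι`, bundled bilinear `Q`).

* `gronwallBound_zero_mul` — `gronwallBound 0 K (a ε) x = a · gronwallBound 0 K ε x`;
* `quad_expand` — `Q (a+d) (a+d) = Q a a + (Q a d + Q d a) + Q d d`;
* `hasDerivWithinAt_flow_initial` — **C¹ dependence on initial data**: for a family of solutions `ψ θ` from
  `x + θ • v` (`θ ∈ Θ`) on `[0,t]`, all of norm `≤ R`, and `V` the solution of the variational equation
  `V' = Q(ψ θ₀, V) + Q(V, ψ θ₀)`, `V 0 = v`, the end-point map `θ ↦ ψ θ t` has derivative `V t` within `Θ` at `θ₀`.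
  Proof: two Grönwall estimates (`norm_le_gronwallBound_of_norm_deriv_right_le`): `ψ θ − ψ θ₀ = O(θ−θ₀)` by the
  Lipschitz constant `2CR` of the field on the ball, then `ψ θ − ψ θ₀ − (θ−θ₀)•V = O((θ−θ₀)²)` since its
  derivative is `Q(ψ θ₀, ·) + Q(·, ψ θ₀)` of itself plus the quadratic defect `Q(Δ,Δ)`; `O((θ−θ₀)²) = o(θ−θ₀)`.
  No `b·m·t < 1`, no analyticity, no openness of `Θ` (one-sided at the ends of a segment);
* `hasDerivWithinAt_flowSel_initial` — the `Fin n` / `flowSel` corollary in (F4)-shape: under the rough-enclosure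
  tests for the states `x + θ•v` (`θ ∈ [0,1]`) and for the variation box, `θ ↦ flowSel Q (x + θ•v) t` is
  differentiable within `[0,1]` with derivative `V t`, `V` the variational solution along `flowSel Q (x + θ₀•v)`,
  confined to `[loV, hiV]` (so `|V t c| ≤ max |loV c| |hiV c|` bounds the segment derivative coordinatewise).

MODEL-lattice bookkeeping only (rung TL-M3 of the NS ladder: one finite-dimensional model ODE); nothing
here is a statement about the Navier–Stokes equations.
-/

noncomputable section

-- the sub-problem namespace repeats the summit name by design (D-0017)
set_option linter.dupNamespace false

namespace Summit.NavierStokesRegularity.NavierStokesRegularity.Theorems.TaylorModelVector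

open scoped BigOperators Topology
open Set Filter Metric Asymptotics

/-- `gronwallBound 0 K · x` is linear. [folklore] -/
theorem gronwallBound_zero_mul (K a ε x : ℝ) : gronwallBound 0 K (a * ε) x = a * gronwallBound 0 K ε x := by
  by_cases hK : K = 0
  · subst hK
    simp only [gronwallBound_K0]
    ring
  · simp only [gronwallBound_of_K_ne_0 hK]
    ring

section General

variable {ι : Type*} [Fintype ι] [DecidableEq ι]
  (Q : (ι → ℝ) →ₗ[ℝ] (ι → ℝ) →ₗ[ℝ] ι → ℝ)

omit [Fintype ι] [DecidableEq ι] in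
/-- `Q (a+d) (a+d) = Q a a + (Q a d + Q d a) + Q d d`. [folklore] -/
theorem quad_expand (a d : ι → ℝ) : Q (a + d) (a + d) = Q a a + (Q a d + Q d a) + Q d d := by
  rw [map_add Q, LinearMap.add_apply, map_add (Q a), map_add (Q d)]
  abel

omit [Fintype ι] [DecidableEq ι] in
/-- The linearisation defect: `Q(a+d,a+d) − Q(a,a) − r•(Q(a,V)+Q(V,a)) = Q(a,e) + Q(e,a) + Q(d,d)` with
`e = d − r•V`. [folklore] -/
theorem quad_lin_defect (a d V : ι → ℝ) (r : ℝ) :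
    Q (a + d) (a + d) - Q a a - r • (Q a V + Q V a) = Q a (d - r • V) + Q (d - r • V) a + Q d d := by
  rw [quad_expand Q a d, map_sub (Q a), map_smul (Q a), map_sub Q, LinearMap.sub_apply, map_smul Q,
    LinearMap.smul_apply, smul_add]
  abel

/-- **DIFFERENTIABLE DEPENDENCE ON THE INITIAL CONDITION ALONG A SEGMENT (no step restriction).** Let `ψ θ`
(`θ ∈ Θ`) solve `u' = Q(u,u)` on `[0,t]` from `x + θ • v`, all bounded in norm by `R` on `[0,t]`, and let `V` solve
the variational equation `V' = Q(ψ θ₀ s, V) + Q(V, ψ θ₀ s)`, `V 0 = v`, on `[0,t]` (`θ₀ ∈ Θ`).  Then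
`θ ↦ ψ θ t` has derivative `V t` within `Θ` at `θ₀`. [folklore] -/
theorem hasDerivWithinAt_flow_initial {x v : ι → ℝ} {t R : ℝ} (ht : 0 ≤ t) {Θ : Set ℝ} {θ₀ : ℝ}
    (hθ₀ : θ₀ ∈ Θ) {ψ : ℝ → ℝ → ι → ℝ} (hψ0 : ∀ θ ∈ Θ, ψ θ 0 = x + θ • v)
    (hψ : ∀ θ ∈ Θ, ∀ s ∈ Icc 0 t, HasDerivWithinAt (ψ θ) (Q (ψ θ s) (ψ θ s)) (Icc 0 t) s)
    (hR : ∀ θ ∈ Θ, ∀ s ∈ Icc 0 t, ‖ψ θ s‖ ≤ R) {V : ℝ → ι → ℝ} (hV0 : V 0 = v)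
    (hV : ∀ s ∈ Icc 0 t, HasDerivWithinAt V (Q (ψ θ₀ s) (V s) + Q (V s) (ψ θ₀ s)) (Icc 0 t) s) :
    HasDerivWithinAt (fun θ => ψ θ t) (V t) Θ θ₀ := by
  obtain ⟨C, hC0, hC⟩ := exists_norm_Q_le Q
  have ht' : t ∈ Icc 0 t := ⟨ht, le_rfl⟩
  have hR0 : 0 ≤ R := (norm_nonneg _).trans (hR θ₀ hθ₀ 0 ⟨le_rfl, ht⟩)
  set K : ℝ := 2 * C * R with hK
  have hK0 : 0 ≤ K := by positivity
  have hL := lipschitzOnWith_quad Q hC0 hC hR0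
  have hnhds : ∀ s ∈ Ico (0:ℝ) t, Icc 0 t ∈ 𝓝[≥] s := fun s hs =>
    mem_of_superset (Icc_mem_nhdsGE hs.2) (Icc_subset_Icc_left hs.1)
  -- Step 1: Lipschitz dependence on `θ`
  set M₁ : ℝ := ‖v‖ * Real.exp (K * t) with hM₁
  have step1 : ∀ θ ∈ Θ, ∀ s ∈ Icc 0 t, ‖ψ θ s - ψ θ₀ s‖ ≤ |θ - θ₀| * M₁ := by
    intro θ hθ s hs
    have hcont : ContinuousOn (fun σ => ψ θ σ - ψ θ₀ σ) (Icc 0 t) := fun σ hσ =>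
      ((hψ θ hθ σ hσ).sub (hψ θ₀ hθ₀ σ hσ)).continuousWithinAt
    have hder : ∀ σ ∈ Ico 0 t, HasDerivWithinAt (fun σ => ψ θ σ - ψ θ₀ σ)
        (Q (ψ θ σ) (ψ θ σ) - Q (ψ θ₀ σ) (ψ θ₀ σ)) (Ici σ) σ := fun σ hσ =>
      ((hψ θ hθ σ (Ico_subset_Icc_self hσ)).sub
        (hψ θ₀ hθ₀ σ (Ico_subset_Icc_self hσ))).mono_of_mem_nhdsWithin (hnhds σ hσ)
    have h0 : ‖ψ θ 0 - ψ θ₀ 0‖ ≤ |θ - θ₀| * ‖v‖ := by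
      rw [hψ0 θ hθ, hψ0 θ₀ hθ₀, show x + θ • v - (x + θ₀ • v) = (θ - θ₀) • v by rw [sub_smul]; abel,
        norm_smul, Real.norm_eq_abs]
    have hbound : ∀ σ ∈ Ico 0 t,
        ‖Q (ψ θ σ) (ψ θ σ) - Q (ψ θ₀ σ) (ψ θ₀ σ)‖ ≤ K * ‖ψ θ σ - ψ θ₀ σ‖ + 0 := by
      intro σ hσ
      have h1 := hL.norm_sub_le (mem_closedBall_zero_iff.2 (hR θ hθ σ (Ico_subset_Icc_self hσ)))
        (mem_closedBall_zero_iff.2 (hR θ₀ hθ₀ σ (Ico_subset_Icc_self hσ)))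
      rw [Real.coe_toNNReal _ (by positivity)] at h1
      rw [add_zero, hK]
      exact h1
    have G := norm_le_gronwallBound_of_norm_deriv_right_le hcont hder h0 hbound s hs
    rw [gronwallBound_ε0, sub_zero] at G
    calc ‖ψ θ s - ψ θ₀ s‖ ≤ |θ - θ₀| * ‖v‖ * Real.exp (K * s) := G
      _ ≤ |θ - θ₀| * ‖v‖ * Real.exp (K * t) := by gcongr; exact hs.2
      _ = |θ - θ₀| * M₁ := by rw [hM₁]; ring
  -- Step 2: quadratic remainder of the linearisation
  set M₂ : ℝ := gronwallBound 0 K (C * M₁ ^ 2) t with hM₂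
  have step2 : ∀ θ ∈ Θ, ‖ψ θ t - ψ θ₀ t - (θ - θ₀) • V t‖ ≤ (θ - θ₀) ^ 2 * M₂ := by
    intro θ hθ
    have hcont : ContinuousOn (fun σ => ψ θ σ - ψ θ₀ σ - (θ - θ₀) • V σ) (Icc 0 t) := fun σ hσ =>
      (((hψ θ hθ σ hσ).sub (hψ θ₀ hθ₀ σ hσ)).sub ((hV σ hσ).const_smul (θ - θ₀))).continuousWithinAt
    have hder : ∀ σ ∈ Ico 0 t, HasDerivWithinAt (fun σ => ψ θ σ - ψ θ₀ σ - (θ - θ₀) • V σ)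
        (Q (ψ θ σ) (ψ θ σ) - Q (ψ θ₀ σ) (ψ θ₀ σ)
          - (θ - θ₀) • (Q (ψ θ₀ σ) (V σ) + Q (V σ) (ψ θ₀ σ))) (Ici σ) σ := fun σ hσ =>
      (((hψ θ hθ σ (Ico_subset_Icc_self hσ)).sub (hψ θ₀ hθ₀ σ (Ico_subset_Icc_self hσ))).sub
        ((hV σ (Ico_subset_Icc_self hσ)).const_smul (θ - θ₀))).mono_of_mem_nhdsWithin (hnhds σ hσ)
    have h0 : ‖ψ θ 0 - ψ θ₀ 0 - (θ - θ₀) • V 0‖ ≤ 0 := by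
      rw [hψ0 θ hθ, hψ0 θ₀ hθ₀, hV0, show x + θ • v - (x + θ₀ • v) - (θ - θ₀) • v = 0 by
        rw [sub_smul]; abel, norm_zero]
    have hbound : ∀ σ ∈ Ico 0 t,
        ‖Q (ψ θ σ) (ψ θ σ) - Q (ψ θ₀ σ) (ψ θ₀ σ) - (θ - θ₀) • (Q (ψ θ₀ σ) (V σ) + Q (V σ) (ψ θ₀ σ))‖
          ≤ K * ‖ψ θ σ - ψ θ₀ σ - (θ - θ₀) • V σ‖ + C * M₁ ^ 2 * (θ - θ₀) ^ 2 := by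
      intro σ hσ
      have alg := quad_lin_defect Q (ψ θ₀ σ) (ψ θ σ - ψ θ₀ σ) (V σ) (θ - θ₀)
      rw [add_sub_cancel] at alg
      rw [alg]
      have na : ‖ψ θ₀ σ‖ ≤ R := hR θ₀ hθ₀ σ (Ico_subset_Icc_self hσ)
      have nd : ‖ψ θ σ - ψ θ₀ σ‖ ≤ |θ - θ₀| * M₁ := step1 θ hθ σ (Ico_subset_Icc_self hσ)
      calc ‖Q (ψ θ₀ σ) (ψ θ σ - ψ θ₀ σ - (θ - θ₀) • V σ)
            + Q (ψ θ σ - ψ θ₀ σ - (θ - θ₀) • V σ) (ψ θ₀ σ) + Q (ψ θ σ - ψ θ₀ σ) (ψ θ σ - ψ θ₀ σ)‖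
          ≤ ‖Q (ψ θ₀ σ) (ψ θ σ - ψ θ₀ σ - (θ - θ₀) • V σ)‖
            + ‖Q (ψ θ σ - ψ θ₀ σ - (θ - θ₀) • V σ) (ψ θ₀ σ)‖ + ‖Q (ψ θ σ - ψ θ₀ σ) (ψ θ σ - ψ θ₀ σ)‖ :=
            norm_add₃_le
        _ ≤ C * ‖ψ θ₀ σ‖ * ‖ψ θ σ - ψ θ₀ σ - (θ - θ₀) • V σ‖
            + C * ‖ψ θ σ - ψ θ₀ σ - (θ - θ₀) • V σ‖ * ‖ψ θ₀ σ‖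
            + C * ‖ψ θ σ - ψ θ₀ σ‖ * ‖ψ θ σ - ψ θ₀ σ‖ :=
            add_le_add (add_le_add (hC _ _) (hC _ _)) (hC _ _)
        _ ≤ C * R * ‖ψ θ σ - ψ θ₀ σ - (θ - θ₀) • V σ‖
            + C * ‖ψ θ σ - ψ θ₀ σ - (θ - θ₀) • V σ‖ * R
            + C * (|θ - θ₀| * M₁) * (|θ - θ₀| * M₁) := by gcongr
        _ = K * ‖ψ θ σ - ψ θ₀ σ - (θ - θ₀) • V σ‖ + C * M₁ ^ 2 * (θ - θ₀) ^ 2 := by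
            rw [hK, ← sq_abs (θ - θ₀)]; ring
    have G := norm_le_gronwallBound_of_norm_deriv_right_le hcont hder h0 hbound t ht'
    rw [sub_zero, show C * M₁ ^ 2 * (θ - θ₀) ^ 2 = (θ - θ₀) ^ 2 * (C * M₁ ^ 2) by ring,
      gronwallBound_zero_mul] at G
    exact G
  -- Step 3: `O((θ−θ₀)²) = o(θ−θ₀)`
  rw [hasDerivWithinAt_iff_isLittleO]
  have big : (fun θ => ψ θ t - ψ θ₀ t - (θ - θ₀) • V t) =O[𝓝[Θ] θ₀] fun θ => ‖θ - θ₀‖ ^ 2 := by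
    refine IsBigO.of_bound M₂ ?_
    filter_upwards [self_mem_nhdsWithin] with θ hθ
    rw [norm_pow, norm_norm, Real.norm_eq_abs, sq_abs, mul_comm]
    exact step2 θ hθ
  exact big.trans_isLittleO ((isLittleO_pow_sub_sub θ₀ one_lt_two).mono nhdsWithin_le_nhds)

end General

/-! ### `Fin n` corollary in (F4)-shape: the segment derivative of the global selector -/

section Majorant

open Summit.NavierStokesRegularity.NavierStokesRegularity.Theorems.TaylorModelMajorant

variable {n : ℕ} {Q : (Fin n → ℝ) → (Fin n → ℝ) → Fin n → ℝ} {w : Fin n → ℝ} {b : ℝ}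
  {T : (Fin n → ℝ) → ℕ → Fin n → ℝ} {U : (Fin n → ℝ) → (Fin n → ℝ) → ℕ → Fin n → ℝ}

/-- **Segment derivative of the selector, no step restriction** ((F4)-shape supplier): if every state
`x + θ • v`, `θ ∈ [0,1]`, passes the rough-enclosure test for the box `[lo,hi]` on `[0,h]`, and the variation box
`[loV,hiV] ∋ v` passes the variational test `v + u • (Q y d + Q d y) ∈ [loV,hiV]`, then for `θ₀ ∈ [0,1]` and
`t ∈ [0,h]` there is a variational solution `V` along `flowSel Q (x + θ₀ • v)` with `V 0 = v`, confined to
`[loV,hiV]`, and `θ ↦ flowSel Q (x + θ • v) t` has derivative `V t` within `[0,1]` at `θ₀`. [folklore] -/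
theorem hasDerivWithinAt_flowSel_initial (hS : IsMajorantSystem n Q w b T U)
    {lo hi loV hiV x v : Fin n → ℝ} {h : ℝ} (hh : 0 ≤ h)
    (hseg : ∀ θ ∈ Icc (0:ℝ) 1, x + θ • v ∈ Icc lo hi) (hv : v ∈ Icc loV hiV)
    (henc : ∀ θ ∈ Icc (0:ℝ) 1, ∀ y ∈ Icc lo hi, ∀ u ∈ Icc (0:ℝ) h, (x + θ • v) + u • Q y y ∈ Icc lo hi)
    (hencV : ∀ y ∈ Icc lo hi, ∀ d ∈ Icc loV hiV, ∀ u ∈ Icc (0:ℝ) h,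
      v + u • (Q y d + Q d y) ∈ Icc loV hiV)
    {θ₀ : ℝ} (hθ₀ : θ₀ ∈ Icc (0:ℝ) 1) {t : ℝ} (ht : t ∈ Icc 0 h) :
    ∃ V : ℝ → Fin n → ℝ, V 0 = v ∧
      (∀ s ∈ Icc 0 h, HasDerivWithinAt V
        (Q (flowSel Q (x + θ₀ • v) s) (V s) + Q (V s) (flowSel Q (x + θ₀ • v) s)) (Icc 0 h) s) ∧
      (∀ s ∈ Icc 0 h, V s ∈ Icc loV hiV) ∧
      HasDerivWithinAt (fun θ => flowSel Q (x + θ • v) t) (V t) (Icc 0 1) θ₀ := by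
  obtain ⟨Qb, hQb⟩ := exists_bundle hS
  have hencV' : ∀ y ∈ Icc lo hi, ∀ d ∈ Icc loV hiV, ∀ u ∈ Icc (0:ℝ) h,
      v + u • (Qb y d + Qb d y) ∈ Icc loV hiV := by simpa only [hQb] using hencV
  have henc' : ∀ y ∈ Icc lo hi, ∀ u ∈ Icc (0:ℝ) h, (x + θ₀ • v) + u • Qb y y ∈ Icc lo hi := by
    simpa only [hQb] using henc θ₀ hθ₀
  obtain ⟨ψ₀, V, hψ00, hV0, hψ0der, hVder, -, hVbox⟩ :=
    exists_pair_sol_mem_Icc_of_roughEnclosure Qb (hseg θ₀ hθ₀) hv hh henc' hencV'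
  have hsol₀ : IsSolOn Q (x + θ₀ • v) h ψ₀ := ⟨hψ00, by simpa only [hQb] using hψ0der⟩
  have heq₀ : ∀ s ∈ Icc 0 h, flowSel Q (x + θ₀ • v) s = ψ₀ s := fun s hs => hS.flowSel_eq hsol₀ hs
  have hVder' : ∀ s ∈ Icc 0 h, HasDerivWithinAt V
      (Q (flowSel Q (x + θ₀ • v) s) (V s) + Q (V s) (flowSel Q (x + θ₀ • v) s)) (Icc 0 h) s := by
    intro s hs
    rw [heq₀ s hs]
    simpa only [hQb] using hVder s hs
  refine ⟨V, hV0, hVder', hVbox, ?_⟩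
  -- the family of selectors from the segment
  have hfam : ∀ θ ∈ Icc (0:ℝ) 1, IsSolOn Q (x + θ • v) h (fun s => flowSel Q (x + θ • v) s) ∧
      ∀ s ∈ Icc 0 h, flowSel Q (x + θ • v) s ∈ Icc lo hi :=
    fun θ hθ => flowSel_isSolOn_mem_Icc hS (hseg θ hθ) hh (henc θ hθ)
  have hsub : Icc 0 t ⊆ Icc 0 h := Icc_subset_Icc_right ht.2
  refine hasDerivWithinAt_flow_initial Qb (ψ := fun θ s => flowSel Q (x + θ • v) s)
    (R := max ‖lo‖ ‖hi‖) ht.1 hθ₀ (fun θ _ => flowSel_zero _) ?_ ?_ hV0 ?_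
  · intro θ hθ s hs
    have h1 := (isSolOn_restrict (hfam θ hθ).1 ht).2 s hs
    simpa only [hQb] using h1
  · exact fun θ hθ s hs => norm_le_of_mem_Icc ((hfam θ hθ).2 s (hsub hs))
  · intro s hs
    have h1 := (hVder' s (hsub hs)).mono hsub
    simpa only [hQb] using h1

end Majorant

end Summit.NavierStokesRegularity.NavierStokesRegularity.Theorems.TaylorModelVector

end
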